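import Literature.AlgebraicGeometry.HodgeTheory.AbelianVarietyCyclotomicAutomorphismCMType
import HarnessLib

/-!
# The CM type from the analytic character: `t ∈ Φ(δ) ⟺ Σ_{k<m} ζ_t^{−k} Tr_a(δ^k) ≠ 0`, and at the CM level
# `Σ_{k<m} ζ_t^{−k} Tr_a(δ^k) ∈ {0, m}` with `t ∈ Φ(δ) ⟺ = m` — the CM type of a cyclotomic automorphism is
# COMPUTABLE from the traces `Tr_a(δ^k)` (e.g. holomorphic Lefschetz data of a curve automorphism)

Family `hodge`, lane `lit-hodgefound` (seat p03, GEN 36 «Hodge classes from the analytic type of a cyclotomic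
automorphism»), topic `Literature/AlgebraicGeometry/HodgeTheory`.  Theorems only: no definition, no instance, no named
fact (net Literature debt 0).  Junction BY NAME of GEN 35's character formula
`natCast_mul_eigenMultiplicity_eq_sum_of_pow_eq_one` (`m · n_ζ(φ) = Σ_{k<m} ζ^{−k} Tr_a(φ^k)` for `φ^m = 1`, `ζ^m = 1`:
the multiplicity of the character `ζ` in the analytic representation of the cyclic group) with GEN 36's CM type
(`cmTypeOf A δ m = {t | n_{e^{2πit/m}}(δ) ≠ 0}`, `…CMType`: `n ∈ {0,1}` at the CM level).

## Sources, verbatim (held texts)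

Yu. G. Zarhin, *Jacobians with automorphisms of prime order*, arXiv:2109.06794, held `paper:arxiv-2109.06794`, §1
Lemma 1.9 (chunk p0004 L55–L60): «Let `φ^* : Ω¹(𝒞) → Ω¹(𝒞)` be the automorphism of `Ω¹(𝒞)` induced by `φ` and `τ`
the trace of `φ^*`. Then `τ = Σ_{j=1}^{p-1} a_j ζ_p^j`»; §1 (chunk p0003 L40–L47): «we write `𝐚_X = 𝐚_{X,δ} : μ_p^* → ℤ_+`,
`a_j = 𝐚_X(ζ_p^j)` — the multiplicity function».

J.-P. Serre, *Linear Representations of Finite Groups* (1977) [SerreLinearRepresentations1977], §2.3 Thm. 4 («the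
number of `W_i` isomorphic to `W` is `(φ|χ)`»), §5.1 (characters of the cyclic group: `χ_h(r^k) = w^{hk}`).

G. Shimura, *Abelian Varieties with Complex Multiplication and Modular Functions* (1998), §5.2 (chunk p0051): «`S` is
equivalent to the direct sum of […] `φ_1, …, φ_n` […] The set `{φ_1, …, φ_n}` being thus determined».

## What is proved (namespace `Literature.AlgebraicGeometry.HodgeTheory.AbelianVariety`)

* §1 (any `(A, δ)` with `Φ_m(δ) = 0`) `sum_trace_pow_eq_natCast_mul_eigenMultiplicity`, **`mem_cmTypeOf_iff_sum_trace_ne_zero`**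
  (`t ∈ Φ(δ) ⟺ Σ_{k<m} ζ_t^{−k} Tr_a(δ^k) ≠ 0`), `cmTypeOf_eq_of_forall_trace_pow_eq` (equal characters ⟹ equal types).
* §2 (CM level `φ(m) = 2 dim A`) **`sum_trace_pow_eq_zero_or_eq`** (`Σ ∈ {0, m}` for `ζ^m = 1`),
  **`mem_cmTypeOf_iff_sum_trace_eq`** (`t ∈ Φ(δ) ⟺ Σ = m`), `not_mem_cmTypeOf_iff_sum_trace_eq_zero`.

## References

* [Zarhin2021PrimeOrderJacobians] Yu. G. Zarhin, arXiv:2109.06794, §1 Lemma 1.9 (chunk p0004), §1 (chunk p0003).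
* [SerreLinearRepresentations1977] J.-P. Serre, *Linear Representations of Finite Groups*, §2.3 Thm. 4, §5.1.
* [Shimura1998] G. Shimura, *Abelian Varieties with Complex Multiplication and Modular Functions* (1998), §5.2 (chunk p0051).
-/

noncomputable section

open CategoryTheory Module Polynomial

namespace Literature.AlgebraicGeometry.HodgeTheory

namespace AbelianVariety

open Literature.AlgebraicTopology.SingularHomology
open Literature.AlgebraicGeometry.Motives.AbelianVariety (Lie lieMapRingHom)

variable {A : Motives.AbelianVariety ℂ} {δ : A ⟶ A} {m : ℕ}

/-- `(e^{2πit/m})^m = 1`. [folklore] -/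
private theorem exp_val_pow_eq_one (hm : 0 < m) (t : ZMod m) :
    Complex.exp (2 * Real.pi * Complex.I * ((t.val : ℂ) / (m : ℂ))) ^ m = 1 := by
  rw [show Complex.exp (2 * Real.pi * Complex.I * ((t.val : ℂ) / (m : ℂ))) =
      Complex.exp (2 * Real.pi * Complex.I / m) ^ t.val by rw [← Complex.exp_nat_mul]; congr 1; ring,
    pow_right_comm, (Complex.isPrimitiveRoot_exp m hm.ne').pow_eq_one, one_pow]

/-! ## §1 The CM type from the character (any level) -/

/-- **`Σ_{k<m} ζ^{−k} Tr_a(δ^k) = m · n_ζ(δ)`** for `Φ_m(δ) = 0` and `ζ^m = 1` (character theory of `⟨δ⟩ ≅ ℤ/m` on `T₀A`).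
[cite: SerreLinearRepresentations1977, §2.3 Thm. 4 and §5.1] [cite: Zarhin2021PrimeOrderJacobians, §1 Lemma 1.9 (chunk p0004 L55–L60)] -/
theorem sum_trace_pow_eq_natCast_mul_eigenMultiplicity (hm : 0 < m)
    (hδ : (cyclotomic m ℤ).eval₂ (Int.castRingHom (End A)) (End.of δ) = 0) {ζ : ℂ} (hζ : ζ ^ m = 1) :
    ∑ k ∈ Finset.range m, ζ⁻¹ ^ k * LinearMap.trace ℂ (Lie A) (lieMapRingHom A (End.of δ ^ k)) =
      (m : ℂ) * eigenMultiplicity A δ ζ :=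
  (natCast_mul_eigenMultiplicity_eq_sum_of_pow_eq_one hm (pow_eq_one_of_cyclotomic hδ) hζ).symm

/-- **The CM type from the analytic character**: `t ∈ cmTypeOf A δ m ⟺ Σ_{k<m} e^{−2πikt/m} Tr_a(δ^k) ≠ 0`.
[cite: Zarhin2021PrimeOrderJacobians, §1 Lemma 1.9 (chunk p0004 L55–L60)] [cite: Shimura1998, §5.2 (chunk p0051)] -/
theorem mem_cmTypeOf_iff_sum_trace_ne_zero (hm : 0 < m)
    (hδ : (cyclotomic m ℤ).eval₂ (Int.castRingHom (End A)) (End.of δ) = 0) (t : ZMod m) :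
    t ∈ cmTypeOf A δ m ↔
      ∑ k ∈ Finset.range m, (Complex.exp (2 * Real.pi * Complex.I * ((t.val : ℂ) / (m : ℂ))))⁻¹ ^ k *
        LinearMap.trace ℂ (Lie A) (lieMapRingHom A (End.of δ ^ k)) ≠ 0 := by
  rw [mem_cmTypeOf_iff_eigenMultiplicity_ne_zero,
    sum_trace_pow_eq_natCast_mul_eigenMultiplicity hm hδ (exp_val_pow_eq_one hm t), mul_ne_zero_iff]
  simp [hm.ne']

/-- **Equal analytic characters give equal CM types** (any `A`, `B`; `Φ_m(δ_A) = 0 = Φ_m(δ_B)`).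
[cite: Zarhin2021PrimeOrderJacobians, §1 Lemma 1.9 (chunk p0004 L55–L60)] [cite: Shimura1998, §5.2 (chunk p0051)] -/
theorem cmTypeOf_eq_of_forall_trace_pow_eq {B : Motives.AbelianVariety ℂ} {δB : B ⟶ B} (hm : 0 < m)
    (hδ : (cyclotomic m ℤ).eval₂ (Int.castRingHom (End A)) (End.of δ) = 0)
    (hδB : (cyclotomic m ℤ).eval₂ (Int.castRingHom (End B)) (End.of δB) = 0)
    (h : ∀ k : ℕ, LinearMap.trace ℂ (Lie A) (lieMapRingHom A (End.of δ ^ k)) =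
      LinearMap.trace ℂ (Lie B) (lieMapRingHom B (End.of δB ^ k))) :
    cmTypeOf A δ m = cmTypeOf B δB m := by
  ext t
  rw [mem_cmTypeOf_iff_sum_trace_ne_zero hm hδ, mem_cmTypeOf_iff_sum_trace_ne_zero hm hδB]
  simp_rw [h]

/-! ## §2 The CM level: `Σ ∈ {0, m}` -/

/-- **At the CM level `Σ_{k<m} ζ^{−k} Tr_a(δ^k) ∈ {0, m}`** for every `m`-th root of unity `ζ` (`n_ζ ∈ {0, 1}`).
[cite: Shimura1998, §5.2 (chunk p0051)] [cite: Zarhin2021PrimeOrderJacobians, §1 Lemma 1.9 (chunk p0004 L55–L60)] -/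
theorem sum_trace_pow_eq_zero_or_eq (hm : 0 < m)
    (hδ : (cyclotomic m ℤ).eval₂ (Int.castRingHom (End A)) (End.of δ) = 0) (hg : Nat.totient m = 2 * A.dim)
    {ζ : ℂ} (hζ : ζ ^ m = 1) :
    ∑ k ∈ Finset.range m, ζ⁻¹ ^ k * LinearMap.trace ℂ (Lie A) (lieMapRingHom A (End.of δ ^ k)) = 0 ∨
      ∑ k ∈ Finset.range m, ζ⁻¹ ^ k * LinearMap.trace ℂ (Lie A) (lieMapRingHom A (End.of δ ^ k)) = m := by
  rw [sum_trace_pow_eq_natCast_mul_eigenMultiplicity hm hδ hζ]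
  rcases eigenMultiplicity_eq_zero_or_eq_one hm hδ hg ζ with h | h
  · exact Or.inl (by rw [h, Nat.cast_zero, mul_zero])
  · exact Or.inr (by rw [h, Nat.cast_one, mul_one])

/-- **At the CM level: `t ∈ cmTypeOf A δ m ⟺ Σ_{k<m} e^{−2πikt/m} Tr_a(δ^k) = m`.**
[cite: Shimura1998, §5.2 (chunk p0051)] [cite: Zarhin2021PrimeOrderJacobians, §1 Lemma 1.9 (chunk p0004 L55–L60)] -/
theorem mem_cmTypeOf_iff_sum_trace_eq (hm : 0 < m)
    (hδ : (cyclotomic m ℤ).eval₂ (Int.castRingHom (End A)) (End.of δ) = 0) (hg : Nat.totient m = 2 * A.dim)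
    (t : ZMod m) :
    t ∈ cmTypeOf A δ m ↔
      ∑ k ∈ Finset.range m, (Complex.exp (2 * Real.pi * Complex.I * ((t.val : ℂ) / (m : ℂ))))⁻¹ ^ k *
        LinearMap.trace ℂ (Lie A) (lieMapRingHom A (End.of δ ^ k)) = m := by
  have hm' : (m : ℂ) ≠ 0 := Nat.cast_ne_zero.2 hm.ne'
  rw [mem_cmTypeOf_iff_eigenMultiplicity_eq_one hm hδ hg,
    sum_trace_pow_eq_natCast_mul_eigenMultiplicity hm hδ (exp_val_pow_eq_one hm t)]
  constructor
  · intro h; rw [h, Nat.cast_one, mul_one]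
  · intro h
    exact_mod_cast mul_left_cancel₀ hm' (h.trans (mul_one (m : ℂ)).symm)

/-- **… and `t ∉ cmTypeOf A δ m ⟺ Σ = 0`.** [cite: Shimura1998, §5.2 (chunk p0051)] -/
theorem not_mem_cmTypeOf_iff_sum_trace_eq_zero (hm : 0 < m)
    (hδ : (cyclotomic m ℤ).eval₂ (Int.castRingHom (End A)) (End.of δ) = 0) (t : ZMod m) :
    t ∉ cmTypeOf A δ m ↔
      ∑ k ∈ Finset.range m, (Complex.exp (2 * Real.pi * Complex.I * ((t.val : ℂ) / (m : ℂ))))⁻¹ ^ k *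
        LinearMap.trace ℂ (Lie A) (lieMapRingHom A (End.of δ ^ k)) = 0 := by
  rw [mem_cmTypeOf_iff_sum_trace_ne_zero hm hδ, not_not]

end AbelianVariety

end Literature.AlgebraicGeometry.HodgeTheory

end
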